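import Summits.CriticalPhenomena.CardyFormulaZ2.Theorems.CardyUniqueLimitCardyRigidityDefs
import Summits.CriticalPhenomena.CardyFormulaZ2.Theorems.CardyBoundaryCoulombGasHalfPlaneMarkDensityLawBoxExhaustionPart5
import HarnessLib

/-!
# Loewner–Carathéodory convergence kit, III: the modulus `η` of the line is the cross-ratio of the image points

Crux `Summit.CriticalPhenomena.CardyFormulaZ2.Theses.CardyUniqueLimit.CardyRigidity`
(stmt-CriticalPhenomena-0746), line `crossing_martingale`, helper kit for the registered stub A3b
`stub_slitObservableApprox`; sequel of `…LoewnerKit.lean`, `…LoewnerKit2.lean`.  Cross-ratio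
bookkeeping (L5): for the SIGN-REVERSED driver `-W` with marks `x₀ < x₁ < x₂` (boundary points
`-x₂ < -x₁ < -x₀ < 0` to the left of the tip for `W`) the modulus `etaProc` of the line's
definitions module is the tree's `crossRatio` (`ConformalRectangle.lean`,
`η = (v₀ - v₁)(v₂ - v₃)/((v₀ - v₂)(v₁ - v₃))`) of the image points under the Loewner map
`g_t = Loewner.map W t`:

    η_t(-W; x) = crossRatio ![g_t(-x₂), g_t(-x₁), g_t(-x₀), W_t],

i.e. the modulus of the conformal rectangle `(ℍ ∖ K_t; -x₂, -x₁, -x₀, tip)` with the arcs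
`(g(-x₂), g(-x₁)) ↔ (g(-x₀), W_t)` paired — the `0 ↔ 2` pairing of
`ConformalRectangle.HasCrossingLimit`, for which `crossRatio → 0` as the rectangle gets long
(`x₁ ↓ x₀`) — together with the continuity of `crossRatio` off its degenerate locus.

References: Werner (2007) §3; Smirnov (2001) Thm 1; Ahlfors (1979) Ch. 3 §3.1; Lawler (2005) §4.1.
-/

noncomputable section

open Set Filter Topology
open scoped NNReal
open Literature.Probability.RandomPlanarGeometry Literature.Probability.RandomPlanarGeometry.Loewner

namespace Summit.CriticalPhenomena.CardyFormulaZ2.Cruxes.CardyRigidity.CrossingMartingale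

namespace LoewnerKit

/-! ### (L5) The modulus of the sign-reversed driver is the cross-ratio of the image points -/

section CrossRatio

/-- The cross-ratio of four real points is continuous at every strictly monotone tuple
`a < b < c < d` (a rational function off its poles: the tree's
`HalfPlaneMarkDensityLaw.SketchLine.BoxExhaustion.continuousAt_crossRatio`,
`…crossRatio_den_ne_zero`). [cite: Ahlfors1979, Ch. 3 §3.1] -/
theorem continuousAt_crossRatio_of_strictMono {v : Fin 4 → ℝ} (h : StrictMono v) :
    ContinuousAt crossRatio v :=
  HalfPlaneMarkDensityLaw.SketchLine.BoxExhaustion.continuousAt_crossRatio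
    (HalfPlaneMarkDensityLaw.SketchLine.BoxExhaustion.crossRatio_den_ne_zero h)

/-- **Cardy's `η` in terms of the image points**: with `Xⁱ = W - gᵢ`,
`cardyEta X⁰ X¹ X² = crossRatio ![g₂, g₁, g₀, W]` (numerators and denominators agree
identically). [cite: Werner2007, §3] -/
theorem cardyEta_eq_crossRatio (W g₀ g₁ g₂ : ℝ) :
    cardyEta (W - g₀) (W - g₁) (W - g₂) = crossRatio ![g₂, g₁, g₀, W] := by
  simp only [cardyEta, crossRatio, Matrix.cons_val_zero, Matrix.cons_val_one, Matrix.cons_val]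
  have h1 : (W - g₀) * (W - g₂ - (W - g₁)) = (g₂ - g₁) * (g₀ - W) := by ring
  have h2 : (W - g₁) * (W - g₂ - (W - g₀)) = (g₂ - g₀) * (g₁ - W) := by ring
  rw [h1, h2]

/-- **(L5) The modulus of the line for the SIGN-REVERSED driver is the tree's cross-ratio of the
image points.**  For a continuous driving function `W` and marks `x₀ < x₁ < x₂` read for `-W`
(i.e. boundary points `-x₂ < -x₁ < -x₀` to the LEFT of the tip for `W`), as long as the three
points are alive, `η_t(-W; x) = crossRatio ![g_t(-x₂), g_t(-x₁), g_t(-x₀), W_t]` with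
`g_t = Loewner.map W t` (real at alive real points): the conformal rectangle
`(ℍ ∖ K_t; -x₂, -x₁, -x₀, tip)` uniformized by `g_t`, arcs `(g(-x₂), g(-x₁)) ↔ (g(-x₀), W_t)` — the
`0 ↔ 2` pairing of `ConformalRectangle.HasCrossingLimit`, for which `crossRatio → 0` as the
rectangle gets long (`x₁ ↓ x₀`). (`realFlowStop (-W) x = -realFlowStop W (-x)`,
`Loewner.realFlowStop_neg_neg`.) [cite: Werner2007, §3] [cite: Smirnov2001, Thm 1] -/
theorem etaProc_neg_eq_crossRatio {Ω : Type*} {W : Ω → ℝ≥0 → ℝ} {ω : Ω} (hc : Continuous (W ω))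
    {x : Fin 3 → ℝ} {t : ℝ≥0}
    (halive : ∀ i, (t : WithTop ℝ≥0) < swallowingTime (W ω) ((-x i : ℝ) : ℂ)) :
    etaProc (fun ω r ↦ -W ω r) x t ω =
      crossRatio ![(map (W ω) t ((-x 2 : ℝ) : ℂ)).re, (map (W ω) t ((-x 1 : ℝ) : ℂ)).re,
        (map (W ω) t ((-x 0 : ℝ) : ℂ)).re, W ω t] := by
  have hX : ∀ i, markFlow (fun ω r ↦ -W ω r) (x i) t ω = W ω t - (map (W ω) t ((-x i : ℝ) : ℂ)).re := by
    intro i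
    show realFlowStop (fun r ↦ -W ω r) (x i) t = _
    have h1 := realFlowStop_neg_neg hc (-x i) t
    rw [neg_neg] at h1
    rw [h1, realFlowStop_of_lt (halive i), realFlow_apply]
    ring
  simp only [etaProc, hX]
  exact cardyEta_eq_crossRatio _ _ _ _

/-- The same with the alive hypothesis read for the sign-reversed driver (`T_{x}(-W) = T_{-x}(W)`,
`Loewner.swallowingTime_neg_ofReal`), e.g. supplied by `lt_swallowingTime_marks_of_le_levelTime`
before the level time. [cite: Werner2007, §3] -/
theorem etaProc_neg_eq_crossRatio' {Ω : Type*} {W : Ω → ℝ≥0 → ℝ} {ω : Ω} (hc : Continuous (W ω))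
    {x : Fin 3 → ℝ} {t : ℝ≥0}
    (halive : ∀ i, (t : WithTop ℝ≥0) < swallowingTime (fun r ↦ -W ω r) (x i)) :
    etaProc (fun ω r ↦ -W ω r) x t ω =
      crossRatio ![(map (W ω) t ((-x 2 : ℝ) : ℂ)).re, (map (W ω) t ((-x 1 : ℝ) : ℂ)).re,
        (map (W ω) t ((-x 0 : ℝ) : ℂ)).re, W ω t] := by
  refine etaProc_neg_eq_crossRatio hc fun i ↦ ?_
  have h := swallowingTime_neg_ofReal (W ω) (-x i)
  simp only [neg_neg] at h
  rw [← h]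
  exact_mod_cast halive i

/-- **(L5, path-space form)** For a continuous path `u` (the Loewner driver of the curve) and its
sign reversal `-u` read on driving-path space as in `PercSlitObservableApprox`: as long as the marks
are alive for `-u`, `η_t = crossRatio ![g^u_t(-x₂), g^u_t(-x₁), g^u_t(-x₀), u_t]`.
[cite: Werner2007, §3] -/
theorem etaProc_eval_neg_eq_crossRatio {u : ℝ≥0 → ℝ} (hu : Continuous u) {x : Fin 3 → ℝ} {t : ℝ≥0}
    (halive : ∀ i, (t : WithTop ℝ≥0) < swallowingTime (fun r ↦ -u r) (x i)) :
    etaProc (fun (w : C(ℝ≥0, ℝ)) (r : ℝ≥0) ↦ w r) x t ⟨fun r ↦ -u r, hu.neg⟩ =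
      crossRatio ![(map u t ((-x 2 : ℝ) : ℂ)).re, (map u t ((-x 1 : ℝ) : ℂ)).re,
        (map u t ((-x 0 : ℝ) : ℂ)).re, u t] :=
  etaProc_neg_eq_crossRatio' (Ω := Unit) (W := fun _ ↦ u) (ω := ()) hu halive

end CrossRatio

end LoewnerKit

/-- **Registered form** (anchor `loewnerKit_etaProc_eval_neg_eq_crossRatio` of stmt-CriticalPhenomena-0746): on
driving-path space, the modulus of the sign-reversed driver is the cross-ratio of the image points under the Loewner
map of the original driver, as long as the marks are alive. [cite: Werner2007, §3] -/
theorem loewnerKit_etaProc_eval_neg_eq_crossRatio : ∀ {u : NNReal → ℝ} (hu : Continuous u) {x : Fin 3 → ℝ} {t : NNReal}, (∀ i, (t : WithTop NNReal) < Literature.Probability.RandomPlanarGeometry.Loewner.swallowingTime (fun r ↦ -u r) (x i)) → etaProc (fun (w : ContinuousMap NNReal ℝ) (r : NNReal) ↦ w r) x t ⟨fun r ↦ -u r, hu.neg⟩ = Literature.Probability.RandomPlanarGeometry.crossRatio ![(Literature.Probability.RandomPlanarGeometry.Loewner.map u t ((-x 2 : ℝ) : ℂ)).re, (Literature.Probability.RandomPlanarGeometry.Loewner.map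 u t ((-x 1 : ℝ) : ℂ)).re, (Literature.Probability.RandomPlanarGeometry.Loewner.map u t ((-x 0 : ℝ) : ℂ)).re, u t] :=
  fun hu _ _ halive ↦ LoewnerKit.etaProc_eval_neg_eq_crossRatio hu halive

end Summit.CriticalPhenomena.CardyFormulaZ2.Cruxes.CardyRigidity.CrossingMartingale

end
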